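import Literature.NumberTheory.GaloisRepresentations.LubinTateColemanRelativeCoordTwo
import Literature.NumberTheory.GaloisRepresentations.LubinTateColemanRelativeLogDerivSurjModTwo
import HarnessLib

/-!
# Theorem I.3.7 over an unramified base `k' = E` at `q = 2`: the KERNEL of `β ↦ r_β`

De Shalit, *Iwasawa theory of elliptic curves with complex multiplication* (1987), Ch. I §3.4 Corollary ("`i` is injective")
and §3.7 Theorem, §3.14.  In the power-series currency of the tree (`f = πX + X²`, `|𝓀_F| = 2`, `π = 2u`; `E ⊆ F^{nr}` finite Galois
with Frobenius `φ`; `β ∈ 𝒰(E·K_π^∞)` with relative Coleman series `g_β`, `δβ = δ_E g_β`, `(δβ)~ = (1 + u⁻¹X)·(r_β ∘ f)`,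
`LubinTateColemanRelativeCoordTwo`) we determine the fibres of `β ↦ r_β`:

* `relLogDerivSeries_eq_of_relUnitCoordTwo_eq` — if the relative anomaly map `c ↦ c − u·φ(c)` of `𝒪_E` is injective (de
  Shalit's `N < ∞`) then `r_β = r_{β'} ⟹ δβ = δβ'` (twisted `h ↦ h̃` is injective at fixed constant term);
* ★★ `exists_unit_of_relLogDerivSeries_eq` (characteristic `0`) — **`δβ = δβ'` iff `g_{β'} = e·g_β` for a unit `e ∈ 𝒪_E^×` with
  `φ(e) = e²`, and then `β'_m = (φ^{-(m+1)} e)·β_m` for all `m`**: the kernel of `δ` on `𝒰(E·K_π^∞)` is the group of such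
  twisted constant sequences — the roots of unity of `E` of order prime to `2` (`φ e = e²` forces `e^{2^d−1} = 1`), which die on
  de Shalit's principal units;
* ★★ `eq_of_relUnitCoordTwo_eq_of_norm_sub_one_lt` — **on PRINCIPAL norm-coherent units (`β_0, β'_0 ≡ 1`) the map `β ↦ r_β`
  is injective** when `c ↦ c − u·φ(c)` is injective (`e ≡ 1 (mod 𝔪_E)` and `φ(e) = e²` force `e = 1`: `‖φ(x)‖ = ‖x‖` but
  `‖2x + x²‖ < ‖x‖`) — the exactness on the left of de Shalit's `0 → 𝒰 → Λ → (𝒪_{k'}/p^N)(1) → 0` for `N < ∞`.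

Everything PROVED (0 sorry).

## References

* E. de Shalit, *Iwasawa theory of elliptic curves with complex multiplication* (1987), Ch. I §3.4 Corollary, §3.7 Theorem, §3.14.
  [deShalit1987]
-/

noncomputable section

open scoped PowerSeries.WithPiTopology

namespace Literature.NumberTheory.GaloisRepresentations

/-- Ultrametric inequality for differences. [folklore] -/
private theorem norm_sub_le_max' {M : Type*} [SeminormedAddCommGroup M] [IsUltrametricDist M] (x y : M) :
    ‖x - y‖ ≤ max ‖x‖ ‖y‖ := by
  rw [sub_eq_add_neg, ← norm_neg y]; exact IsUltrametricDist.norm_add_le_max x (-y)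

section RelativeCoordKernelTwo

open GaloisRepresentations.IsNonarchimedeanLocalField LubinTate ValuativeRel Field

variable {F : Type} [Field F] [ValuativeRel F] [TopologicalSpace F] [IsNonarchimedeanLocalField F]

attribute [local instance] ltNormUniformSpace ltNormIsUniformAddGroup rk1 nF nE fintypeResidueField

variable {π : 𝒪[F]} (hπ : (valuation F).IsUniformizer (π : F))
variable (E : IntermediateField F (AlgebraicClosure F)) [FiniteDimensional F E] [Normal F E] [IsGalois F E]
variable (hq : residueFieldCard F = 2) (hE : E ≤ maxUnramified F) {σ₀ : absoluteGaloisGroup F} (hσ₀ : IsAbsArithFrob σ₀)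

/-! ### `r_β = r_{β'} ⟹ δβ = δβ'` when the anomaly map is injective -/

/-- ★ **`r_β = r_{β'} ⟹ δβ = δβ'`** when `c ↦ c − u·φ(c)` is injective on `𝒪_E` (`(δβ)~ = (δβ')~` have constant terms
`c − uφ(c)`, `c' − uφ(c')` with `c = (δβ)(0)`, so `c = c'`, and `h ↦ h̃` is injective at fixed constant term).
[cite: deShalit1987, Ch. I §3.7 Theorem, §3.14] -/
theorem relLogDerivSeries_eq_of_relUnitCoordTwo_eq (u : (LTCoeff F)ˣ) (hu : LTCoeff.of F π = residueFieldCard F * u)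
    (hinj : ∀ c : unitBall E, c = algebraMap (LTCoeff F) (unitBall E) u * (frobUnitBall E σ₀ : unitBall E →+* unitBall E) c → c = 0)
    {β β' : RelNormCoherentUnits hπ E} (h : relUnitCoordTwo hπ E hq hE hσ₀ u hu β = relUnitCoordTwo hπ E hq hE hσ₀ u hu β') :
    relLogDerivSeries hπ E hq hE hσ₀ β = relLogDerivSeries hπ E hq hE hσ₀ β' := by
  have ht : relTildeSeries hπ E hq hE hσ₀ (u : LTCoeff F) β = relTildeSeries hπ E hq hE hσ₀ (u : LTCoeff F) β' := by
    rw [relTildeSeries_eq_relUnitCoordTwo hπ E hq hE hσ₀ u hu β, relTildeSeries_eq_relUnitCoordTwo hπ E hq hE hσ₀ u hu β', h]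
  refine twistedTilde_injective_of_constantCoeff_eq hπ E (u : LTCoeff F) (frobUnitBall_algebraMap_pi E σ₀) ht ?_
  have h0 := congrArg PowerSeries.constantCoeff ht
  rw [constantCoeff_relTildeSeries, constantCoeff_relTildeSeries] at h0
  rw [← sub_eq_zero]
  refine hinj _ ?_
  rw [map_sub ((frobUnitBall E σ₀ : unitBall E →+* unitBall E)), mul_sub]
  linear_combination h0

/-! ### The kernel of `δ`: `δβ = δβ'` iff `g_{β'} = e·g_β`, `φ(e) = e²` -/

omit [Normal F E] [IsGalois F E] in
/-- `𝒩_E(C e) = C(e²)` (`(𝒩_E(C e)) ∘ f = C e · τ_E(C e) = C e²`). [cite: deShalit1987, Ch. I §2.1] -/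
theorem relNormTwo_C (e : unitBall E) : relNormTwo hπ E hq (PowerSeries.C e) = PowerSeries.C (e * e) := by
  refine subst_map_ltSer_injective hπ E ?_
  change PowerSeries.subst _ (relNormTwo hπ E hq (PowerSeries.C e)) = PowerSeries.subst _ (PowerSeries.C (e * e))
  rw [subst_relNormTwo, reflE_C, ← map_mul, PowerSeries.subst_C]
  rfl

omit [Normal F E] [IsGalois F E] in
/-- `𝒪_E` is additively torsion-free in characteristic `0`. [folklore] -/
private theorem isAddTorsionFree_unitBall [CharZero F] : IsAddTorsionFree (unitBall E) := by
  haveI : CharZero E := charZero_of_injective_algebraMap (algebraMap F E).injective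
  refine ⟨fun n hn x y hxy => ?_⟩
  apply Subtype.ext
  have h1 : (n : E) * (x : E) = (n : E) * (y : E) := by
    have := congrArg (fun z : unitBall E => (z : E)) hxy
    simpa [nsmul_eq_mul] using this
  exact mul_left_cancel₀ (Nat.cast_ne_zero.mpr hn) h1

omit [Normal F E] [IsGalois F E] in
/-- **Units with the same `δ_E` differ by a constant**: `δ_E G = δ_E G' ⟹ G' = C e · G` with `e = (G' G⁻¹)(0)`
(characteristic `0`: `(G'/G)' = 0`). [cite: deShalit1987, Ch. I §3.4 Corollary] -/
theorem eq_C_mul_of_relLogDeriv_eq [CharZero F] (G G' : (PowerSeries (unitBall E))ˣ)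
    (h : relLogDeriv hπ E G = relLogDeriv hπ E G') :
    (G' : PowerSeries (unitBall E)) =
      PowerSeries.C (PowerSeries.constantCoeff ((G' * G⁻¹ : (PowerSeries (unitBall E))ˣ) : PowerSeries (unitBall E))) * G := by
  haveI := isAddTorsionFree_unitBall (F := F) E
  -- `dlog G = dlog G'` (`ι ω_F` is a unit)
  have hω : IsUnit ((invDiff (isLTRing_LTCoeff hπ) (isLTSeries_LTCoeff π)).map (algebraMap (LTCoeff F) (unitBall E))) := by
    rw [PowerSeries.isUnit_iff_constantCoeff, ← PowerSeries.coeff_zero_eq_constantCoeff_apply, PowerSeries.coeff_map,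
      PowerSeries.coeff_zero_eq_constantCoeff_apply, constantCoeff_invDiff, map_one]
    exact isUnit_one
  rw [relLogDeriv_def, relLogDeriv_def] at h
  have hd : PowerSeries.dlog G = PowerSeries.dlog G' := hω.mul_right_inj.mp h
  -- `dlog (G' G⁻¹) = 0`, so `(G' G⁻¹)' = 0`
  have hW : PowerSeries.dlog (G' * G⁻¹) = 0 := by
    have h1 : PowerSeries.dlog (G * G⁻¹) = 0 := by rw [mul_inv_cancel, PowerSeries.dlog_one]
    rw [PowerSeries.dlog_mul] at h1 ⊢
    rw [← hd]; linear_combination h1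
  have hW' : PowerSeries.derivative (unitBall E) ((G' * G⁻¹ : (PowerSeries (unitBall E))ˣ) : PowerSeries (unitBall E)) = 0 := by
    rw [PowerSeries.dlog_def] at hW
    have := congrArg (fun V => V * ((G' * G⁻¹ : (PowerSeries (unitBall E))ˣ) : PowerSeries (unitBall E))) hW
    simpa only [mul_assoc, Units.inv_mul, mul_one, zero_mul] using this
  have hWC : ((G' * G⁻¹ : (PowerSeries (unitBall E))ˣ) : PowerSeries (unitBall E)) =
      PowerSeries.C (PowerSeries.constantCoeff ((G' * G⁻¹ : (PowerSeries (unitBall E))ˣ) : PowerSeries (unitBall E))) :=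
    PowerSeries.derivative.ext (by rw [hW', PowerSeries.derivative_C]) (by rw [PowerSeries.constantCoeff_C])
  have e1 : (G' : PowerSeries (unitBall E)) = ((G' * G⁻¹ : (PowerSeries (unitBall E))ˣ) : PowerSeries (unitBall E)) * G := by
    rw [Units.val_mul, mul_assoc, Units.inv_mul, mul_one]
  conv_lhs => rw [e1, hWC]

omit [Normal F E] [IsGalois F E] in
/-- `(G^ψ)(0) = ψ(G(0))`. [folklore] -/
private theorem constantCoeff_map_eq (ψ : unitBall E →+* unitBall E) (G : PowerSeries (unitBall E)) :
    PowerSeries.constantCoeff (PowerSeries.map ψ G) = ψ (PowerSeries.constantCoeff G) := by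
  rw [← PowerSeries.coeff_zero_eq_constantCoeff_apply, PowerSeries.coeff_map, PowerSeries.coeff_zero_eq_constantCoeff_apply]

set_option maxHeartbeats 800000 in
/-- ★★ **The kernel of `δ` on `𝒰(E·K_π^∞)`** (characteristic `0`): if `δβ = δβ'` then there is a unit `e ∈ 𝒪_E^×` with
**`φ(e) = e²`, `g_{β'} = e · g_β`, and `β'_m = (φ^{-(m+1)} e) · β_m` for every `m`** (`g_{β'} = e g_β` by `eq_C_mul_of_relLogDeriv_eq`;
`φ(e) = e²` from `𝒩_E(e g) = (e g)^φ`; the values from `β_m = ((φ⁻¹)^{m+1} g_β)^ι(ω_{m+1})`).  Such `e` are roots of unity of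
order prime to `2`; on principal units they are `1`. [cite: deShalit1987, Ch. I §3.4 Corollary, §3.12 Corollary] -/
theorem exists_unit_of_relLogDerivSeries_eq [CharZero F] {β β' : RelNormCoherentUnits hπ E}
    (h : relLogDerivSeries hπ E hq hE hσ₀ β = relLogDerivSeries hπ E hq hE hσ₀ β') :
    ∃ e : (unitBall E)ˣ, (frobUnitBall E σ₀ : unitBall E →+* unitBall E) e = (e : unitBall E) ^ 2 ∧
      relColemanSeries hπ E hq hE hσ₀ β' = PowerSeries.C (e : unitBall E) * relColemanSeries hπ E hq hE hσ₀ β ∧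
      ∀ m : ℕ, ((β'.val m : unitBall (E ⊔ ltField π m : IntermediateField F (AlgebraicClosure F))) :
          (E ⊔ ltField π m : IntermediateField F (AlgebraicClosure F))) =
        ((inclUnitBall (F := F) (le_sup_left : E ≤ E ⊔ ltField π m)
            ((((frobUnitBall E σ₀).symm : unitBall E →+* unitBall E) ^ (m + 1)) (e : unitBall E)) :
            unitBall (E ⊔ ltField π m : IntermediateField F (AlgebraicClosure F))) :
          (E ⊔ ltField π m : IntermediateField F (AlgebraicClosure F))) *
        ((β.val m : unitBall (E ⊔ ltField π m : IntermediateField F (AlgebraicClosure F))) :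
          (E ⊔ ltField π m : IntermediateField F (AlgebraicClosure F))) := by
  -- the constant `e`
  have hGG := eq_C_mul_of_relLogDeriv_eq hπ E (isUnit_relColemanSeries hπ E hq hE hσ₀ β).unit
    (isUnit_relColemanSeries hπ E hq hE hσ₀ β').unit h
  obtain ⟨W, hW⟩ : ∃ W : (PowerSeries (unitBall E))ˣ,
      W = (isUnit_relColemanSeries hπ E hq hE hσ₀ β').unit * ((isUnit_relColemanSeries hπ E hq hE hσ₀ β).unit)⁻¹ := ⟨_, rfl⟩
  rw [← hW, IsUnit.unit_spec, IsUnit.unit_spec] at hGG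
  have he : IsUnit (PowerSeries.constantCoeff (W : PowerSeries (unitBall E))) := PowerSeries.isUnit_constantCoeff _ W.isUnit
  refine ⟨he.unit, ?_, by rw [IsUnit.unit_spec]; exact hGG, fun m => ?_⟩
  · -- `φ(e) = e²` from `𝒩_E g_{β'} = g_{β'}^φ`, comparing constant terms
    rw [IsUnit.unit_spec]
    have h1 := relNormTwo_relColemanSeries hπ E hq hE hσ₀ β'
    rw [hGG, relNormTwo_mul, relNormTwo_C, relNormTwo_relColemanSeries hπ E hq hE hσ₀ β,
      map_mul (PowerSeries.map (frobUnitBall E σ₀ : unitBall E →+* unitBall E)), PowerSeries.map_C] at h1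
    have h2 := congrArg PowerSeries.constantCoeff h1
    rw [map_mul (PowerSeries.constantCoeff (R := unitBall E)), map_mul (PowerSeries.constantCoeff (R := unitBall E)),
      PowerSeries.constantCoeff_C, PowerSeries.constantCoeff_C, constantCoeff_map_eq] at h2
    have hu : IsUnit ((frobUnitBall E σ₀ : unitBall E →+* unitBall E) (PowerSeries.constantCoeff (relColemanSeries hπ E hq hE hσ₀ β))) :=
      (isUnit_constantCoeff_relColemanSeries hπ E hq hE hσ₀ β).map _
    rw [pow_two]
    exact (hu.mul_left_inj.mp h2).symm
  · -- the values
    have hv' := evS_relColemanSeries hπ E hq hE hσ₀ β' m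
    rw [hGG, map_iterate_mul, ← map_pow_eq_iterate E _ (m + 1) (PowerSeries.C _), PowerSeries.map_C,
      map_mul (PowerSeries.map (inclUnitBall (F := F) (le_sup_left : E ≤ E ⊔ ltField π m) :
        unitBall E →+* unitBall (E ⊔ ltField π m : IntermediateField F (AlgebraicClosure F)))),
      PowerSeries.map_C, map_mul (evS _ _), evS_C, evS_relColemanSeries hπ E hq hE hσ₀ β m] at hv'
    rw [← hv', IsUnit.unit_spec, Subring.coe_mul]
    rfl

/-! ### Injectivity on principal units -/

omit [Normal F E] [IsGalois F E] in
include hπ hq in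
/-- `‖2‖ < 1` in `𝒪_E` at `q = 2`. [cite: deShalit1987, Ch. I §3.12] -/
private theorem norm_two_lt_one : ‖((2 : unitBall E) : E)‖ < 1 := by
  obtain ⟨c, hc⟩ := Ideal.mem_span_singleton'.mp (two_mem_span_algebraMap_pi hπ E hq)
  have e2 : ((2 : unitBall E) : E) = ((c : unitBall E) : E) * ((algebraMap 𝒪[F] (unitBall E) π : unitBall E) : E) := by
    rw [← Subring.coe_mul, hc]
  rw [e2, norm_mul]
  calc ‖((c : unitBall E) : E)‖ * ‖((algebraMap 𝒪[F] (unitBall E) π : unitBall E) : E)‖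
      ≤ 1 * ‖((algebraMap 𝒪[F] (unitBall E) π : unitBall E) : E)‖ :=
        mul_le_mul_of_nonneg_right ((mem_unitBall_iff E).mp c.2) (norm_nonneg _)
    _ < 1 := by rw [one_mul]; exact norm_algebraMap_pi_lt_one hπ E

omit [IsGalois F E] in
include hπ hq in
/-- **A unit `e ≡ 1 (mod 𝔪_E)` with `φ(e) = e²` is `1`** (`e = 1 + x`: `φ(x) = 2x + x²` has norm `< ‖x‖ = ‖φ(x)‖` unless `x = 0`).
[cite: deShalit1987, Ch. I §3.12 Corollary] -/
theorem eq_one_of_frob_eq_sq_of_norm_sub_one_lt {e : unitBall E}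
    (he : (frobUnitBall E σ₀ : unitBall E →+* unitBall E) e = e ^ 2) (h1 : ‖((e - 1 : unitBall E) : E)‖ < 1) : e = 1 := by
  obtain ⟨x, hx⟩ : ∃ x : unitBall E, x = e - 1 := ⟨_, rfl⟩
  have hex : e = 1 + x := by rw [hx, add_sub_cancel]
  rw [← hx] at h1
  have hφx : (frobUnitBall E σ₀ : unitBall E →+* unitBall E) x = 2 * x + x * x := by
    have h2 := he
    rw [hex, map_add ((frobUnitBall E σ₀ : unitBall E →+* unitBall E)), map_one] at h2
    linear_combination h2
  have hnorm : ‖(((frobUnitBall E σ₀ : unitBall E →+* unitBall E) x : unitBall E) : E)‖ = ‖(x : E)‖ := norm_unitBallEquiv E _ x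
  by_contra hne
  have hx0 : x ≠ 0 := fun h0 => hne (by rw [hex, h0, add_zero])
  have hxpos : 0 < ‖(x : E)‖ := norm_pos_iff.mpr fun h0 => hx0 (Subtype.ext h0)
  have hlt : ‖(((2 * x + x * x : unitBall E)) : E)‖ < ‖(x : E)‖ := by
    rw [Subring.coe_add, Subring.coe_mul, Subring.coe_mul]
    refine lt_of_le_of_lt (IsUltrametricDist.norm_add_le_max _ _) (max_lt ?_ ?_)
    · rw [norm_mul]
      calc ‖((2 : unitBall E) : E)‖ * ‖(x : E)‖ < 1 * ‖(x : E)‖ :=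
            mul_lt_mul_of_pos_right (norm_two_lt_one hπ E hq) hxpos
        _ = ‖(x : E)‖ := one_mul _
    · rw [norm_mul]
      calc ‖(x : E)‖ * ‖(x : E)‖ < 1 * ‖(x : E)‖ := mul_lt_mul_of_pos_right h1 hxpos
        _ = ‖(x : E)‖ := one_mul _
  rw [← hφx, hnorm] at hlt
  exact lt_irrefl _ hlt

set_option maxHeartbeats 800000 in
/-- ★★ **Theorem I.3.7 over `k'`, exactness on the left for PRINCIPAL units** (characteristic `0`; `c ↦ c − u·φ(c)` injective on
`𝒪_E`, i.e. de Shalit's `N < ∞`): if `β`, `β'` are norm-coherent units along `E·K_π^∞` with `β_0 ≡ β'_0 ≡ 1 (mod 𝔪)` and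
`r_β = r_{β'}`, then `β = β'`. [cite: deShalit1987, Ch. I §3.7 Theorem] -/
theorem eq_of_relUnitCoordTwo_eq_of_norm_sub_one_lt [CharZero F] (u : (LTCoeff F)ˣ) (hu : LTCoeff.of F π = residueFieldCard F * u)
    (hinj : ∀ c : unitBall E, c = algebraMap (LTCoeff F) (unitBall E) u * (frobUnitBall E σ₀ : unitBall E →+* unitBall E) c → c = 0)
    {β β' : RelNormCoherentUnits hπ E}
    (hβ : ‖((β.val 0 : unitBall (E ⊔ ltField π 0 : IntermediateField F (AlgebraicClosure F))) :
      (E ⊔ ltField π 0 : IntermediateField F (AlgebraicClosure F))) - 1‖ < 1)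
    (hβ' : ‖((β'.val 0 : unitBall (E ⊔ ltField π 0 : IntermediateField F (AlgebraicClosure F))) :
      (E ⊔ ltField π 0 : IntermediateField F (AlgebraicClosure F))) - 1‖ < 1)
    (h : relUnitCoordTwo hπ E hq hE hσ₀ u hu β = relUnitCoordTwo hπ E hq hE hσ₀ u hu β') : β = β' := by
  obtain ⟨e, he, -, hval⟩ := exists_unit_of_relLogDerivSeries_eq hπ E hq hE hσ₀
    (relLogDerivSeries_eq_of_relUnitCoordTwo_eq hπ E hq hE hσ₀ u hu hinj h)
  -- `e' := φ⁻¹ e ≡ 1`: `β'_0 = ι(e')·β_0` with `β_0, β'_0 ≡ 1` and `‖β_0‖ = 1`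
  obtain ⟨e', he'⟩ : ∃ e' : unitBall E, e' = (((frobUnitBall E σ₀).symm : unitBall E →+* unitBall E) ^ (0 + 1)) (e : unitBall E) :=
    ⟨_, rfl⟩
  have hval0 := hval 0
  rw [← he'] at hval0
  have hb1 : ‖((β.val 0 : unitBall (E ⊔ ltField π 0 : IntermediateField F (AlgebraicClosure F))) :
      (E ⊔ ltField π 0 : IntermediateField F (AlgebraicClosure F)))‖ = 1 := β.norm_eq_one 0
  have hιe : ‖((inclUnitBall (F := F) (le_sup_left : E ≤ E ⊔ ltField π 0) e' :
      unitBall (E ⊔ ltField π 0 : IntermediateField F (AlgebraicClosure F))) :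
      (E ⊔ ltField π 0 : IntermediateField F (AlgebraicClosure F))) - 1‖ < 1 := by
    have e1 : (((inclUnitBall (F := F) (le_sup_left : E ≤ E ⊔ ltField π 0) e' :
        unitBall (E ⊔ ltField π 0 : IntermediateField F (AlgebraicClosure F))) :
        (E ⊔ ltField π 0 : IntermediateField F (AlgebraicClosure F))) - 1) *
        ((β.val 0 : unitBall (E ⊔ ltField π 0 : IntermediateField F (AlgebraicClosure F))) :
          (E ⊔ ltField π 0 : IntermediateField F (AlgebraicClosure F))) =
        (((β'.val 0 : unitBall (E ⊔ ltField π 0 : IntermediateField F (AlgebraicClosure F))) :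
          (E ⊔ ltField π 0 : IntermediateField F (AlgebraicClosure F))) - 1) -
        (((β.val 0 : unitBall (E ⊔ ltField π 0 : IntermediateField F (AlgebraicClosure F))) :
          (E ⊔ ltField π 0 : IntermediateField F (AlgebraicClosure F))) - 1) := by
      rw [hval0]; ring
    have h2 := congrArg (fun z => ‖z‖) e1
    simp only [norm_mul, hb1, mul_one] at h2
    rw [h2]
    exact lt_of_le_of_lt (norm_sub_le_max' _ _) (max_lt hβ' hβ)
  have he'1 : ‖((e' - 1 : unitBall E) : E)‖ < 1 := by
    have h3 : ‖((inclUnitBall (F := F) (le_sup_left : E ≤ E ⊔ ltField π 0) (e' - 1) :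
        unitBall (E ⊔ ltField π 0 : IntermediateField F (AlgebraicClosure F))) :
        (E ⊔ ltField π 0 : IntermediateField F (AlgebraicClosure F)))‖ < 1 := by
      rw [map_sub (inclUnitBall (F := F) (le_sup_left : E ≤ E ⊔ ltField π 0)), map_one, AddSubgroupClass.coe_sub,
        OneMemClass.coe_one]
      exact hιe
    rwa [norm_inclUnitBall] at h3
  -- `φ(e') = e'²` as well, so `e' = 1`, `e = 1`
  have hφe' : (frobUnitBall E σ₀ : unitBall E →+* unitBall E) e' = e' ^ 2 := by
    rw [he', zero_add, pow_one]
    change (frobUnitBall E σ₀) ((frobUnitBall E σ₀).symm (e : unitBall E)) = ((frobUnitBall E σ₀).symm (e : unitBall E)) ^ 2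
    rw [RingEquiv.apply_symm_apply, ← map_pow, ← he]
    change (e : unitBall E) = (frobUnitBall E σ₀).symm ((frobUnitBall E σ₀) (e : unitBall E))
    rw [RingEquiv.symm_apply_apply]
  have he'one : e' = 1 := eq_one_of_frob_eq_sq_of_norm_sub_one_lt hπ E hq hφe' he'1
  have heone : (e : unitBall E) = 1 := by
    have h1 := he'
    rw [he'one, zero_add, pow_one] at h1
    change (1 : unitBall E) = (frobUnitBall E σ₀).symm (e : unitBall E) at h1
    rw [RingEquiv.eq_symm_apply, map_one] at h1
    exact h1.symm
  -- all values agree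
  refine RelNormCoherentUnits.ext fun m => Subtype.ext ?_
  have hm := hval m
  rw [heone, map_one, map_one, OneMemClass.coe_one, one_mul] at hm
  exact hm.symm

end RelativeCoordKernelTwo

end Literature.NumberTheory.GaloisRepresentations
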